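import Mathlib
import HarnessLib
import Summits.Langlands.Langlands.Theses.EisensteinMonodromy
import Literature.NumberTheory.GaloisRepresentations.WeilDeligneGeneric
import Literature.NumberTheory.GaloisRepresentations.WeilDeligneDominance
import Literature.NumberTheory.GaloisRepresentations.WeilDeligneOfGaloisProofs

/-!
# Birth skeleton (BC3) for crux stmt-Langlands-10863
`Summit.Langlands.Langlands.Theses.EisensteinMonodromy.GenericMonodromy` — line `birth`

Route `route-Langlands-EisensteinMonodromy` (`closes : GenericMonodromy → EisensteinEnvelopeGeneric →
RankTwoGenericMonodromy → GenericWDUnique → EnvelopeToTarget → MonodromyToLanglands → Assembly →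
Langlands`).  The crux (kind auto-crux, ex-target X of the thesis) says: for `K` CM, `π` regular
algebraic cuspidal on `GL_n(𝔸_K)`, `p`, `ι : ℚ̄_p ≃ ℂ` and every SEMISIMPLE `ρ : Γ_K → GL_n(ℚ̄_p)` with
the Satake-predicted arithmetic-Frobenius characteristic polynomials at cofinitely many places, at
every finite `v ∤ p` some Weil–Deligne representation `W` attached to `ρ|_{W_{K_v}}` by the
Grothendieck–Deligne recipe (`IsWeilDeligneOfLadic`) is GENERIC (Allen 2016, Def. 1.1.2 — the clause
written inline in the crux is literally `WeilDeligneRep.IsGeneric W`, `isGeneric_iff`).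

This file concludes the crux BY NAME from three named stubs, cut along the one seam every engine that
has ever proved a case of it respects (Taylor–Yoshida, Caraiani, Allen–Newton 2020, Matsumoto
arXiv:2312.01551, and the route's own Eisenstein mechanism): Varma's ENVELOPE (a published theorem:
equal semisimplifications and DOMINATED monodromy `≺_I`) / the REVERSE domination (the open content:
"`N` is as large as the automorphic side predicts") / the ALGEBRA turning mutual domination by a
generic representation into genericity.

* `stub_dominatedEnvelope` — for `(K, π, p, ι, ρ, v ∤ p)` as in the crux: SOME `W` is attached to
  `ρ|_{W_{K_v}}` (Grothendieck's `ℓ`-adic monodromy theorem, the tree's named fact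
  `exists_weilDeligneRep_of_ladic` plus the non-degeneracy clause of `IsWeilDeligneOfLadic`), and
  there is a Frobenius-semisimple GENERIC `W'` on the same space with the same Weil-group traces as
  `W` and `W ≺_I W'` (`WeilDeligneRep.PrecI`, Varma Def. 8.3).  In print `W' = ι⁻¹ rec_{K_v}(π_v ⊗
  |det|^{(1-n)/2})^{F-ss}`: `ρ ≅ r_{p,ι}(π)` (HLTT Thm. A + Chebotarev/Brauer–Nesbitt, tree
  `FramedGaloisRep.nonempty_equiv_of_hasFrobCharpolyAt_eventually`), VarmaFMS2024 Thms. 1–2 (tree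
  named fact `Varma2024.theorem12_trace_eq_and_precI`, over `ℂ` through `ι`; transport back along
  `ι⁻¹`, `WeilDeligneRep.IsTransportAlong`), local Langlands for `GL_n(K_v)` (`LocalLanglandsDatum`),
  "`π_v` generic for cuspidal `π`" (Shalika) and "`rec` of a generic `π_v` is generic" (Allen 2016
  Lemma 1.1.3 (1) = BLGGT Lemma 1.3.2 (1)).  KNOWN in print; formally XL (it contains Varma's fact).
* `stub_monodromyRankLowerBound` — the OPEN core, and nothing else: in the same situation, for every
  attached `W` and every Frobenius-semisimple generic `W'` with the traces of `W` and `W ≺_I W'`, also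
  `W' ≺_I W` — i.e. `rk N_W^k|_{V[θ]} ≥ rk N_{W'}^k|_{V'[θ]}` for every irreducible inertial type `θ`
  and every `k`.  This is exactly what AllenNewton2020 Thm. 1.1 (`n = 2`, weight `0`, density-one
  `ℓ`) and arXiv:2312.01551 Thms. 1.1/1.3/1.5 (sectors in `ℓ`) establish, and what the route's rank-2
  crux `EisensteinEnvelopeGeneric` is designed to deliver for all `(n, p)`; implied by the crux
  (genericity is invariant under Frobenius-semisimplification and isomorphism, and a generic
  Frobenius-semisimple representation maximises every such rank among representations with its
  traces), it does NOT give the crux back without the two other stubs.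
* `stub_genericOfMutualDominance` — pure algebra over an algebraically closed field of
  characteristic `0` (provable now, size L): if `W'` is Frobenius-semisimple and generic, `W` has the
  traces of `W'`, `W ≺_I W'` and `W' ≺_I W`, then `W` is generic.  Proof on paper: Brauer–Nesbitt
  gives `(W^{F-ss}).ρ ≅ W'.ρ =: τ`; on each line `{σ ⊗ ‖·‖^a}` of `τ` the monodromy operators are
  representations of an equioriented type-`A` quiver with the same dimension vector; `W'` generic ⇔
  its orbit is the open one (Allen §1.1 / Zelevinsky: no two segments linked ⇔ `Ext¹ = 0`), which
  maximises every interval rank; the `≺_I`-rank equalities, summed over lines with positive weights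
  `dim σ[θ]`, force all interval ranks of `N_W` to be maximal, hence (Abeasis–Del Fra: type-`A`
  orbits are classified by interval ranks) `W^{F-ss} ≅ W'`, so `W^{F-ss}` is generic, so `W` is
  (`Hom_WD(r, r(1)) = 0 ⇔ Hom_WD(r^{F-ss}, r^{F-ss}(1)) = 0`: the unipotent part of Frobenius acts
  unipotently on both Hom-spaces and has fixed vectors).  Refs: VarmaFMS2024 Def. 8.2–8.3, Lemma 8.4,
  Prop. 8.8; BellaicheChenevier2009 §7.8 (Gerstenhaber, `≺`); Allen2016 §1.1; Zelevinsky1980 §§2, 9.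

The composition `GenericMonodromy_of` is kernel-checked and sorry-free: at a place `v ∤ p` it takes
`(W, W')` from stub 1, the reverse domination from stub 2, genericity of `W` from stub 3, and rewrites
`WeilDeligneRep.IsGeneric` into the crux's inline clause (`isGeneric_iff`).  The file also PROVES
(no stub involved) `isGeneric_of_isWeilDeligneOfLadic` — all Weil–Deligne representations attached to
one `ρ|_{W_{K_v}}` are generic together (tree theorem `IsWeilDeligneOfLadic.isEquivalent_holds` +
`IsEquivalent.isGeneric_iff`) — and derives from the three stubs the `∀ W`-form of the crux
(`forall_attached_isGeneric_of`), which is the form provers of `MonodromyToLanglands` /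
`GenericWDUnique` consume.

Shape (for `ledger skeleton check` / `#h21_check_skeleton`): each stub is `theorem stub_<name> : <Prop>
:= by sorry` (closed statements over existing declarations only); `_Goal.stub_<name> : Prop :=
type_of% @stub_<name>` names that statement; `GenericMonodromy_of (h₁ : _Goal.stub_dominatedEnvelope)
(h₂ : _Goal.stub_monodromyRankLowerBound) (h₃ : _Goal.stub_genericOfMutualDominance) :
GenericMonodromy` concludes the route decl BY NAME; the last `example` feeds the three stubs to it.
Sorries: exactly 3, one inside each `stub_*`, none elsewhere (`lean check --json`: rc 0, `sorries: 3` at the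
three `stub_*` declarations; `#print axioms GenericMonodromy_of` = `[propext, Classical.choice,
Quot.sound]`, no `sorryAx`).  BC3 probes (registrar's folder `bc/GenericMonodromy_probe.lean`,
`bc/GenericMonodromy_probe2.lean`): for each stub statement `Sᵢ`, `Sᵢ → GenericMonodromy` and
`Sᵢ → Langlands` by `first | exact? | simpa [Sᵢ, …] | (unfold …; simpa) | aesop` under
`maxHeartbeats 400000` FAIL (6/6: whnf-timeouts resp. `unsolved goals ⊢ Langlands`, aesop exhaustive
search failed); with binders introduced first and `first | exact? | aesop | simp_all` they FAIL again
(6/6), and the converse costume probes `GenericMonodromy → Sᵢ` FAIL (3/3) — no stub is cheaply the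
crux or the summit, and none is cheaply implied by the crux.

Disproof used: none exists — `ledger crux ls stmt-Langlands-10863` lists no workfiles (no
`Disproof.lean`, no `Negative/` lemma, no dead line, no crux ideas) at registration time
(2026-08-17); `ledger negatives --problem Langlands` (3 entries: SplitPrimeInductionDeinduction,
OrdinaryPrimeTransportRankinSelbergPoleCount, K3KugaSatakeDescentSerreTypeAnchor) contains nothing of
the shape of these stubs.  The one refuted fact in this corner, `HarrisLanTaylorThorne2016.not_prop712`
(the route header records it as never load-bearing), is not used: no `2n`-dimensional envelope
appears in this line.
-/

set_option linter.dupNamespace false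

noncomputable section

namespace Summit.Langlands.Langlands.Cruxes.GenericMonodromy.Birth

open Summit.Langlands.Langlands.Theses.EisensteinMonodromy
open Literature.NumberTheory.GaloisRepresentations
open Filter

/-! ## 1. The three stubs -/

/-- **STUB 1 — Varma's envelope, in Weil–Deligne vocabulary over `ℚ̄_p`.**  For `K` CM, `π`
regular algebraic cuspidal on `GL_n(𝔸_K)`, `p`, `ι`, every semisimple `ρ : Γ_K → GL_n(ℚ̄_p)` with the
Satake-predicted Frobenius characteristic polynomials at cofinitely many `v` (so `ρ ≅ r_{p,ι}(π)`),
and every finite `v ∤ p`: some `W` is attached to `ρ|_{W_{K_v}}` by the Grothendieck–Deligne recipe,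
and there is a Frobenius-semisimple GENERIC `W'` on `ℚ̄_p^n` with `tr W.ρ(w) = tr W'.ρ(w)` for all
`w ∈ W_{K_v}` and `W ≺_I W'` — namely `W' = ι⁻¹rec_{K_v}(π_v ⊗ |det|_v^{(1-n)/2})^{F-ss}` (Varma
Thm. 1: equal semisimplifications = equal traces; Thm. 2 with Lemma 8.4 (2): `≺ = ≺_I`; `π_v` is
generic because `π` is cuspidal, and `rec` of a generic representation is generic).  Known in print
for all `n`, `p`, `v ∤ p`; not in the tree (contains the named fact
`Varma2024.theorem12_trace_eq_and_precI`, the local Langlands correspondence and Grothendieck's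
monodromy theorem).  Why it might fail as typed: only through a mismatch of normalisations
(`arithFrobPolyOfSatake` is the C-normalisation matching HLTT's `r_{p,ı}`; genericity and `≺_I` are
insensitive to the `|det|^{(1-n)/2}` twist and to `ι`).
[cite: VarmaFMS2024, Thm. 1, Thm. 2, Lemma 8.4 (2)] [cite: HarrisLanTaylorThorneRMS2016, Thm. A]
[cite: Allen2016, Def. 1.1.2 and Lemma 1.1.3] [cite: DeligneAntwerpII1973, §8.4.2] -/
theorem stub_dominatedEnvelope : ∀ (K : Type) [Field K] [NumberField K], NumberField.IsCMField K → ∀ (n : ℕ) (hcpt : Literature.NumberTheory.Automorphic.isCompact_glFiniteIntegralLevel n K) (π : Literature.NumberTheory.Automorphic.CuspidalAutomorphicRepData n K hcpt), π.1.IsRegularAlgebraic → ∀ (p : ℕ) [Fact p.Prime] (ι : PadicAlgCl p ≃+* ℂ) (ρ : Literature.NumberTheory.GaloisRepresentations.FramedGaloisRep K (PadicAlgCl p) n), ρ.toGaloisRep.IsSemisimple → (∀ᶠ v : IsDedekindDomain.HeightOneSpectrum (NumberField.RingOfIntegers K) in Filter.cofinite, ∀ α : Multiset ℂ, π.1.HasSatakeParamAt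 v α → ρ.IsUnramifiedAt v ∧ ρ.HasFrobCharpolyAt v (Literature.NumberTheory.Automorphic.arithFrobPolyOfSatake ι v.residueCard n α)) → ∀ v : IsDedekindDomain.HeightOneSpectrum (NumberField.RingOfIntegers K), ((p : ℕ) : NumberField.RingOfIntegers K) ∉ v.asIdeal → ∃ W : Literature.NumberTheory.GaloisRepresentations.WeilDeligneRep (v.adicCompletion K) (PadicAlgCl p) (Fin n → PadicAlgCl p), Literature.NumberTheory.GaloisRepresentations.IsWeilDeligneOfLadic (ρ.toLocal v).toWeilGroupHom W ∧ ∃ W' : Literature.NumberTheory.GaloisRepresentations.WeilDeligneRep (v.adicCompletion K) (PadicAlgCl p) (Fin n → PadicAlgCl p), W'.IsFrobSemisimple ∧ W'.IsGeneric ∧ (∀ w : Literature.NumberTheory.GaloisRepresentations.WeilGroup (v.adicCompletion K), LinearMap.trace (PadicAlgCl p) (Fin n → PadicAlgCl p) (W.ρ w) = LinearMap.trace (PadicAlgCl p) (Fin n → PadicAlgCl p) (W'.ρ w)) ∧ W.PrecI W' := by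
  sorry

/-- **STUB 2 — the monodromy rank lower bound (the open core).**  Same situation as stub 1; for
every `W` attached to `ρ|_{W_{K_v}}` and every Frobenius-semisimple generic `W'` with the traces of
`W` and `W ≺_I W'` (Varma's envelope), ALSO `W' ≺_I W`: for every irreducible inertial type `θ` with
open kernel and every `k`, `rk N_W^k|_{V[θ]} ≥ rk N_{W'}^k|_{V'[θ]}` — "the monodromy of `r_{p,ι}(π)`
at `v` is as large as `rec(π_v)` predicts" (the inertial isomorphism `ρ|_{I} ≅ ρ'|_{I}` asked by
`≺_I` comes for free from the hypothesis).  `ℓ`-adic interpolation of characteristic polynomials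
bounds `N` only from above (AllenNewton2020 p. 1: "it doesn't seem possible to understand the
monodromy operator in this way"); known: `n = 2`, weight `0`, Dirichlet-density-one `ℓ`
(AllenNewton2020 Thm. 1.1); all `n` for `ℓ > n²` and `ι`-ordinary `π` under generic residual
hypotheses, and positive-density `ℓ` under self-twist/weight-gap hypotheses, `n = 2` all weights
positive-density `ℓ` (arXiv:2312.01551 Thms. 1.1, 1.3, 1.5); OPEN for general `(n, p)` — small `p`,
`p ∣ disc K`, non-ordinary `π_p`.  Why it might fail: it cannot fail without the crux failing (it is
implied by it), but a reducible `r_ι(π)` with inter-constituent extension classes would make the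
SEMISIMPLE `ρ`'s `N` too small while direction (A) survives with a non-semisimple lattice — the
recorded risk of the crux itself.
[cite: AllenNewton2020, Thm. 1.1] [cite: VarmaFMS2024, Def. 8.3 and Prop. 8.8]
[cite: HarrisLanTaylorThorneRMS2016, Thm. A] -/
theorem stub_monodromyRankLowerBound : ∀ (K : Type) [Field K] [NumberField K], NumberField.IsCMField K → ∀ (n : ℕ) (hcpt : Literature.NumberTheory.Automorphic.isCompact_glFiniteIntegralLevel n K) (π : Literature.NumberTheory.Automorphic.CuspidalAutomorphicRepData n K hcpt), π.1.IsRegularAlgebraic → ∀ (p : ℕ) [Fact p.Prime] (ι : PadicAlgCl p ≃+* ℂ) (ρ : Literature.NumberTheory.GaloisRepresentations.FramedGaloisRep K (PadicAlgCl p) n), ρ.toGaloisRep.IsSemisimple → (∀ᶠ v : IsDedekindDomain.HeightOneSpectrum (NumberField.RingOfIntegers K) in Filter.cofinite, ∀ α : Multiset ℂ, π.1.HasSatakeParamAt v α → ρ.IsUnramifiedAt v ∧ ρ.HasFrobCharpolyAt v (Literature.NumberTheory.Automorphic.arithFrobPolyOfSatake ι v.residueCard n α)) → ∀ v : IsDedekindDomain.HeightOneSpectrum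 (NumberField.RingOfIntegers K), ((p : ℕ) : NumberField.RingOfIntegers K) ∉ v.asIdeal → ∀ W : Literature.NumberTheory.GaloisRepresentations.WeilDeligneRep (v.adicCompletion K) (PadicAlgCl p) (Fin n → PadicAlgCl p), Literature.NumberTheory.GaloisRepresentations.IsWeilDeligneOfLadic (ρ.toLocal v).toWeilGroupHom W → ∀ W' : Literature.NumberTheory.GaloisRepresentations.WeilDeligneRep (v.adicCompletion K) (PadicAlgCl p) (Fin n → PadicAlgCl p), W'.IsFrobSemisimple → W'.IsGeneric → (∀ w : Literature.NumberTheory.GaloisRepresentations.WeilGroup (v.adicCompletion K), LinearMap.trace (PadicAlgCl p) (Fin n → PadicAlgCl p) (W.ρ w) = LinearMap.trace (PadicAlgCl p) (Fin n → PadicAlgCl p) (W'.ρ w)) → W.PrecI W' → W'.PrecI W := by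
  sorry

/-- **STUB 3 — mutual domination by a generic representation forces genericity** (pure algebra,
provable now).  Over an algebraically closed field `E` of characteristic `0`: if `W'` is
Frobenius-semisimple and generic, `W` (arbitrary, on the same space `E^n`) has the Weil-group traces
of `W'`, `W ≺_I W'` and `W' ≺_I W`, then `W` is generic.  On paper: `(W^{F-ss}).ρ ≅ W'.ρ`
(Brauer–Nesbitt; Frobenius-semisimplification keeps traces, `N` and `ρ|_I`, hence `≺_I`); conjugate to
a common `τ`; on each line `{σ ⊗ ‖·‖^a : a ∈ ℤ}` of `τ` (`σ ≇ σ ⊗ ‖·‖^a` for `a ≠ 0` by determinants)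
Schur makes `N`, `N'` representations of an equioriented type-`A` quiver with one dimension vector;
`W'` generic ⇔ `N'` lies in the open orbit (no two segments linked ⇔ `Ext¹ = 0`), which maximises
every interval rank; `rk N^k|_{V[θ]} = Σ_lines dim σ[θ] · Σ_a rk(N : M_a → M_{a+k})`, so the
`≺_I`-equalities force every interval rank of `N` to be maximal, i.e. (type-`A` orbits are classified
by interval ranks) `W^{F-ss} ≅ W'`; genericity passes along the isomorphism
(`WeilDeligneRep.IsEquivalent.isGeneric_iff`) and from `W^{F-ss}` to `W` (the unipotent part of a
Frobenius acts unipotently on `Hom_WD(r^{F-ss}, r^{F-ss}(1))` and fixes a non-zero vector if there is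
one).  Size L in Lean (Brauer–Nesbitt for `W_F`, the line decomposition, Gerstenhaber/Abeasis–Del Fra
for the linear quiver).  Why it might fail: only if "generic ⇔ open orbit" failed for
Frobenius-semisimple representations over `E = Ē` — it is Allen 2016 §1.1 / BLGGT Lemma 1.3.2.
[cite: VarmaFMS2024, Def. 8.3, Lemma 8.4 (2) and Prop. 8.8] [cite: BellaicheChenevier2009, §7.8]
[cite: Allen2016, §1.1] [cite: Zelevinsky1980, §9] [cite: TateCorvallis1979, (4.1.3)–(4.1.5)] -/
theorem stub_genericOfMutualDominance : ∀ (F : Type) [Field F] [ValuativeRel F] [TopologicalSpace F] [IsNonarchimedeanLocalField F] (E : Type) [Field E] [IsAlgClosed E] [CharZero E] (n : ℕ) (W W' : Literature.NumberTheory.GaloisRepresentations.WeilDeligneRep F E (Fin n → E)), W'.IsFrobSemisimple → W'.IsGeneric → (∀ w : Literature.NumberTheory.GaloisRepresentations.WeilGroup F, LinearMap.trace E (Fin n → E) (W.ρ w) = LinearMap.trace E (Fin n → E) (W'.ρ w)) → W.PrecI W' → W'.PrecI W → W.IsGeneric := by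
  sorry

/-! ## 2. The stub statements as named propositions (the composition's hypotheses, by name)

`_Goal` is internal on purpose: audits listing the file's declarations by short name find the `stub_*`
THEOREMS, while `#h21_check_skeleton` accepts the hypotheses of `GenericMonodromy_of` by the stub names
they carry.  Each `_Goal.stub_x` is `type_of% @stub_x` — no text duplicated, no `sorry` inherited. -/

namespace _Goal

/-- The statement of `stub_dominatedEnvelope`, as a named `Prop` (literally its type). [folklore] -/
def stub_dominatedEnvelope : Prop :=
  type_of% @Summit.Langlands.Langlands.Cruxes.GenericMonodromy.Birth.stub_dominatedEnvelope

/-- The statement of `stub_monodromyRankLowerBound`, as a named `Prop` (literally its type).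
[folklore] -/
def stub_monodromyRankLowerBound : Prop :=
  type_of% @Summit.Langlands.Langlands.Cruxes.GenericMonodromy.Birth.stub_monodromyRankLowerBound

/-- The statement of `stub_genericOfMutualDominance`, as a named `Prop` (literally its type).
[folklore] -/
def stub_genericOfMutualDominance : Prop :=
  type_of% @Summit.Langlands.Langlands.Cruxes.GenericMonodromy.Birth.stub_genericOfMutualDominance

end _Goal

/-! ## 3. A theorem of the tree: attached Weil–Deligne representations are generic together -/

/-- **All Weil–Deligne representations attached to one `ρ|_{W_F}` are generic together.**  Two
representations attached to the same `ρW : W_F →* GL_n(E)` by the Grothendieck–Deligne recipe (for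
possibly different `t`, `U`, `Φ`) are isomorphic (Deligne 1973 §8.4.2; in the tree, PROVED:
`IsWeilDeligneOfLadic.isEquivalent_holds`), and genericity is an invariant of the isomorphism class
(`WeilDeligneRep.IsEquivalent.isGeneric_iff`).  So the crux's `∃ W, attached ∧ generic` and the
`∀ W, attached → generic` consumed downstream say the same thing once some `W` is attached.
[cite: DeligneAntwerpII1973, §8.4.2] [cite: Allen2016, §1.1] -/
theorem isGeneric_of_isWeilDeligneOfLadic {F : Type} [Field F] [ValuativeRel F] [TopologicalSpace F]
    [IsNonarchimedeanLocalField F] {E : Type} [Field E] [CharZero E] {n : ℕ}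
    (ρW : WeilGroup F →* GL (Fin n) E) {W₁ W₂ : WeilDeligneRep F E (Fin n → E)}
    (h₁ : IsWeilDeligneOfLadic ρW W₁) (h₂ : IsWeilDeligneOfLadic ρW W₂) (hg : W₁.IsGeneric) :
    W₂.IsGeneric := by
  have hequiv : ∀ {F : Type} [Field F] [ValuativeRel F] [TopologicalSpace F]
      [IsNonarchimedeanLocalField F] {E : Type} [Field E] [CharZero E] {n : ℕ}
      (ρW : WeilGroup F →* GL (Fin n) E) (r r' : WeilDeligneRep F E (Fin n → E)),
      IsWeilDeligneOfLadic ρW r → IsWeilDeligneOfLadic ρW r' → r.IsEquivalent r' :=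
    IsWeilDeligneOfLadic.isEquivalent_holds
  exact (hequiv ρW W₁ W₂ h₁ h₂).isGeneric_iff.mp hg

/-! ## 4. The composition (kernel-checked, no `sorry`): envelope → reverse domination → algebra → crux by name -/

/-- **`GenericMonodromy` from the three stubs.**  At a finite `v ∤ p`: stub 1 attaches `W` to
`ρ|_{W_{K_v}}` and supplies the generic Frobenius-semisimple comparison object `W'` with the traces
of `W` and `W ≺_I W'`; stub 2 gives `W' ≺_I W`; stub 3 turns mutual domination into `W.IsGeneric`,
which is — by `WeilDeligneRep.isGeneric_iff`, i.e. by `Iff.rfl` — the clause written inline in the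
crux.  The hypotheses are, by name, the statements of `stub_dominatedEnvelope`,
`stub_monodromyRankLowerBound`, `stub_genericOfMutualDominance`; the conclusion is the route decl.
[folklore] -/
theorem GenericMonodromy_of (h₁ : _Goal.stub_dominatedEnvelope)
    (h₂ : _Goal.stub_monodromyRankLowerBound) (h₃ : _Goal.stub_genericOfMutualDominance) :
    GenericMonodromy := by
  unfold _Goal.stub_dominatedEnvelope at h₁
  unfold _Goal.stub_monodromyRankLowerBound at h₂
  unfold _Goal.stub_genericOfMutualDominance at h₃
  intro K _ _ hK n hcpt π hπ p _ ι ρ hss hsat v hv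
  -- Varma's envelope at `v`: an attached `W`, a generic Frobenius-semisimple `W'` with the same
  -- traces, and `W ≺_I W'`
  obtain ⟨W, hW, W', hfs, hgen, htr, hprec⟩ := h₁ K hK n hcpt π hπ p ι ρ hss hsat v hv
  -- the rank lower bound: `W' ≺_I W`
  have hrev : W'.PrecI W := h₂ K hK n hcpt π hπ p ι ρ hss hsat v hv W hW W' hfs hgen htr hprec
  -- mutual domination by a generic representation with the same traces forces genericity
  have hWgen : W.IsGeneric := h₃ (v.adicCompletion K) (PadicAlgCl p) n W W' hfs hgen htr hprec hrev
  exact ⟨W, hW, (WeilDeligneRep.isGeneric_iff W).mp hWgen⟩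

/-- **The `∀ W`-form from the same stubs**: under the hypotheses of the crux, EVERY Weil–Deligne
representation attached to `ρ|_{W_{K_v}}` at a finite `v ∤ p` is generic (the composition above plus
`isGeneric_of_isWeilDeligneOfLadic`).  This is the form in which `MonodromyToLanglands` /
`GenericWDUnique` consume the crux. [folklore] -/
theorem forall_attached_isGeneric_of (h₁ : _Goal.stub_dominatedEnvelope)
    (h₂ : _Goal.stub_monodromyRankLowerBound) (h₃ : _Goal.stub_genericOfMutualDominance) :
    ∀ (K : Type) [Field K] [NumberField K], NumberField.IsCMField K → ∀ (n : ℕ)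
      (hcpt : Literature.NumberTheory.Automorphic.isCompact_glFiniteIntegralLevel n K)
      (π : Literature.NumberTheory.Automorphic.CuspidalAutomorphicRepData n K hcpt),
      π.1.IsRegularAlgebraic → ∀ (p : ℕ) [Fact p.Prime] (ι : PadicAlgCl p ≃+* ℂ)
      (ρ : Literature.NumberTheory.GaloisRepresentations.FramedGaloisRep K (PadicAlgCl p) n),
      ρ.toGaloisRep.IsSemisimple →
      (∀ᶠ v : IsDedekindDomain.HeightOneSpectrum (NumberField.RingOfIntegers K) in Filter.cofinite,
        ∀ α : Multiset ℂ, π.1.HasSatakeParamAt v α → ρ.IsUnramifiedAt v ∧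
          ρ.HasFrobCharpolyAt v
            (Literature.NumberTheory.Automorphic.arithFrobPolyOfSatake ι v.residueCard n α)) →
      ∀ v : IsDedekindDomain.HeightOneSpectrum (NumberField.RingOfIntegers K),
        ((p : ℕ) : NumberField.RingOfIntegers K) ∉ v.asIdeal →
        ∀ W : WeilDeligneRep (v.adicCompletion K) (PadicAlgCl p) (Fin n → PadicAlgCl p),
          IsWeilDeligneOfLadic (ρ.toLocal v).toWeilGroupHom W → W.IsGeneric := by
  intro K _ _ hK n hcpt π hπ p _ ι ρ hss hsat v hv W hW
  obtain ⟨W₀, hW₀, hgen₀⟩ := GenericMonodromy_of h₁ h₂ h₃ K hK n hcpt π hπ p ι ρ hss hsat v hv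
  exact isGeneric_of_isWeilDeligneOfLadic (ρ.toLocal v).toWeilGroupHom hW₀ hW
    ((WeilDeligneRep.isGeneric_iff W₀).mpr hgen₀)

/-- By-name sanity check (an `example`, not a declaration of the file): the three stubs feed the
composition as they stand. -/
example : GenericMonodromy :=
  GenericMonodromy_of stub_dominatedEnvelope stub_monodromyRankLowerBound stub_genericOfMutualDominance

end Summit.Langlands.Langlands.Cruxes.GenericMonodromy.Birth

end
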